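import Summits.QuantumFields.YangMills.Theorems.BalabanUVNodesN15KingModelCoverBlockAverages
import Summits.QuantumFields.YangMills.Theorems.BalabanUVNodesN15KingModelToronHeatKernel
import Literature.MathematicalPhysics.QuantumFieldTheory.King1986.CovarianceQstar
import HarnessLib

/-!
# BalabanUVNodes ∕ N15 — THE KING-MODEL RUNG (PART Ͻ-g): THE `U ≡ 1` BRIDGE — PART Ͷ's toron block-spin letters at the trivial phase vector ARE King's real letters of the tree
# mapped to `ℂ`: `Q^1 = Qmat`, `Q^{1*} = N^{d+1}Qmatᵀ`, `A₀(1) = fineOp`, ★★★ `Δ^1_eff = King1986.effLaplacian`, `(Δ^1_eff)⁻¹ = (King1986.effLaplacian)⁻¹` ENTRYWISE — so every theorem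
# of the tree about King's `A = 0` effective Laplacian (η-rates, decay, Lemma 4.5 (4.38)) is a theorem about the toron letters at `ω ≡ 1` (door (t4⁵⁰) of the seat's §g44)
# (Track A, DAG node N15 = NE2; FAN-OUT v1.1 §N15 s3 «KING-MODEL RUNG … + what the curved case adds»; count-neutral)

HONEST FRAMING.  Count-neutral (cell `pub-ymgap`, seat `pub-ymgap-dag-n15-e` g45; `--supports stmt-QuantumFields-27247 --as helper` = K3ᴬ, KEY MAP v3).  Bookkeeping between two
in-tree spellings of the SAME objects of King's `A = 0` model [King1986]: the b05-lineage complex letters (`B5Block118.QsOp`, `B5ToronOperators118.QsOpTw` at `ω ≡ 1`, PART Ͷ-k's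
`fineOpTw`∕`effLapTw`) and the King1986-lineage real letters (`King1986.Torus.Qmat`, `fineOp`, `effLaplacian` of `EffectiveLaplacianSymbol`).  Exact identities; NOT Bałaban's
`G_k(U)`; NOT a node discharge; nothing continuum ∕ ℝ⁴ ∕ OS ∕ Clay.

PROVED HERE:
* §1 `ℝ → ℂ` bookkeeping for matrices: `map_ofReal_mul`, `map_ofReal_add`, `map_ofReal_sub`, `map_ofReal_smul`, `map_ofReal_one`, `conjTranspose_map_ofReal` (`(A_ℂ)ᴴ = (Aᵀ)_ℂ`), ★
  `map_ofReal_inv` (`(A⁻¹)_ℂ = (A_ℂ)⁻¹` for `det A` a unit), `isUnit_det_of_map_ofReal`;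
* §2 `blockOf_bpt`, ★★ **`QsOp_eq_map_Qmat`** (`B5Block118.QsOp N M = (King1986.Torus.Qmat N M)_ℂ` — the two block means of the tree coincide), `QsOpTw_one_eq_map_Qmat`,
  `kingQadjTw_one_eq_map` (`Q^{1*} = (N^{d+1}·Qmatᵀ)_ℂ`), `kingQadjTw_one_mul_QsOpTw_one` (`Q^{1*}Q^1 = (blockProj)_ℂ`, tree `transpose_Qmat_mul_Qmat`);
* §3 ★★ **`fineOpTw_one_eq_map_fineOp`** (`A₀(1) = (fineOp)_ℂ`, with Ͷ-g `toronOp_zero_eq_map_lapF`), ★★★ **`effLapTw_one_eq_map_effLaplacian`** (`Δ^1_eff = (King1986.effLaplacian N M a c m²)_ℂ`,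
  `a, c ≥ 0`, `m² > 0`), ★★ `isUnit_det_effLaplacian` (King's real effective Laplacian is invertible for ALL `c ≥ 0`, `a > 0`, `m² > 0` — the tree's `effLaplacian_isUnit` is the case
  `c = N²`), ★★★ **`effLapTw_one_inv_eq_map`** ∕ **`effLapTw_one_inv_apply`** (`(Δ^1_eff)⁻¹(b,b′) = ((King1986.effLaplacian …)⁻¹(b,b′) : ℂ)`), `norm_effLapTw_one_inv_apply`.
PRIOR TREE ART (by name): Ͻ-b (`exists_bpt_eq`, `bpt_eq_bpt_iff`), Ͻ-e (`QsOpTw_apply_bpt`), Ͷ-k (`kingQadjTw`, `fineOpTw`, `effLapTw`), Ͷ-g (`toronOp_zero_eq_map_lapF`), `B5Block118` (`QsOp`,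
`bpt`), `B5ToronOperators118` (`QsOpTw_one`, `twPow_one`), `B5ToronMomentum161.twistOf_zero`, `King1986.Torus` (`Qmat`, `blockProj`, `blockOf`, `blockOf_site`, `site_eq_bpt`,
`transpose_Qmat_mul_Qmat`, `fineOp`, `fineOp_isUnit`, `effLaplacian`), Mathlib (`Matrix.map_mul`, `RingHom.map_det`, `Matrix.inv_eq_right_inv`).  Dedup (rg at filing): basename 0
files; needles `QsOp_eq_map_Qmat|effLapTw_one_eq_map|fineOpTw_one_eq_map_fineOp|map_ofReal_inv` 0 tree files.  presearch: n/a (bookkeeping).  Locators: [King1986] (2.11)–(2.14)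
p.653, (4.1)–(4.5) p.670; [Balaban1984PropagatorsI] (1.20) p.20, (1.74) p.30; [Balaban1985BackgroundPropagators] (3.19) p.393.  0 `sorry`, 0 `def`.
-/

noncomputable section

open scoped BigOperators ComplexConjugate ComplexOrder
open Finset Matrix

namespace Summit.QuantumFields.YangMills.BalabanUVNodes.N15KingModelRung.Cover

open Literature.MathematicalPhysics.QuantumFieldTheory.Balaban1983to89.B5Prop11Plancherel (Tor fine)
open Literature.MathematicalPhysics.QuantumFieldTheory.Balaban1983to89.B5Block118 (bpt QsOp)
open Literature.MathematicalPhysics.QuantumFieldTheory.Balaban1983to89.B5ToronOperators118 (QsOpTw QsOpTw_one twPow twPow_one)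
open Literature.MathematicalPhysics.QuantumFieldTheory.Balaban1983to89.B5ToronMomentum161 (twistOf twistOf_zero)
open Literature.MathematicalPhysics.QuantumFieldTheory.King1986.Torus (lapF Qmat blockProj blockOf blockOf_site site_eq_bpt transpose_Qmat_mul_Qmat fineOp fineOp_isUnit
  effLaplacian)
open Summit.QuantumFields.YangMills.BalabanUVNodes.N15KingModelRung.Toron (toronOp kingQadjTw fineOpTw effLapTw toronOp_zero_eq_map_lapF isUnit_effLapTw)

/-! ## §1 `ℝ → ℂ` bookkeeping for matrices -/

section MapOfReal

variable {l m n : Type*} [Fintype l] [Fintype m] [Fintype n] [DecidableEq n]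

omit [Fintype l] [Fintype n] [DecidableEq n] in
/-- `(A·B)_ℂ = A_ℂ·B_ℂ`. [folklore] -/
theorem map_ofReal_mul (A : Matrix l m ℝ) (B : Matrix m n ℝ) : (A * B).map ((↑) : ℝ → ℂ) = A.map ((↑) : ℝ → ℂ) * B.map ((↑) : ℝ → ℂ) :=
  Matrix.map_mul (f := Complex.ofRealHom)

omit [Fintype l] [Fintype m] [Fintype n] [DecidableEq n] in
/-- `(A + B)_ℂ = A_ℂ + B_ℂ`. [folklore] -/
theorem map_ofReal_add (A B : Matrix l m ℝ) : (A + B).map ((↑) : ℝ → ℂ) = A.map ((↑) : ℝ → ℂ) + B.map ((↑) : ℝ → ℂ) := by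
  ext i j; simp

omit [Fintype l] [Fintype m] [Fintype n] [DecidableEq n] in
/-- `(A − B)_ℂ = A_ℂ − B_ℂ`. [folklore] -/
theorem map_ofReal_sub (A B : Matrix l m ℝ) : (A - B).map ((↑) : ℝ → ℂ) = A.map ((↑) : ℝ → ℂ) - B.map ((↑) : ℝ → ℂ) := by
  ext i j; simp

omit [Fintype l] [Fintype m] [Fintype n] [DecidableEq n] in
/-- `(r·A)_ℂ = r·A_ℂ`. [folklore] -/
theorem map_ofReal_smul (r : ℝ) (A : Matrix l m ℝ) : (r • A).map ((↑) : ℝ → ℂ) = (r : ℂ) • A.map ((↑) : ℝ → ℂ) := by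
  ext i j; simp

omit [Fintype n] in
/-- `1_ℂ = 1`. [folklore] -/
theorem map_ofReal_one : (1 : Matrix n n ℝ).map ((↑) : ℝ → ℂ) = 1 := by
  ext i j; by_cases h : i = j <;> simp [Matrix.one_apply, h]

omit [Fintype l] [Fintype m] [Fintype n] [DecidableEq n] in
/-- `(A_ℂ)ᴴ = (Aᵀ)_ℂ` for a real matrix. [folklore] -/
theorem conjTranspose_map_ofReal (A : Matrix l m ℝ) : (A.map ((↑) : ℝ → ℂ))ᴴ = Aᵀ.map ((↑) : ℝ → ℂ) := by
  ext i j; simp [Matrix.conjTranspose_apply]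

/-- `det(A_ℂ) = (det A : ℂ)`. [folklore] -/
theorem det_map_ofReal (A : Matrix n n ℝ) : (A.map ((↑) : ℝ → ℂ)).det = ((A.det : ℝ) : ℂ) :=
  (RingHom.map_det Complex.ofRealHom A).symm

/-- A real matrix is invertible iff its complexification is. [folklore] -/
theorem isUnit_det_map_ofReal_iff (A : Matrix n n ℝ) : IsUnit (A.map ((↑) : ℝ → ℂ)).det ↔ IsUnit A.det := by
  rw [det_map_ofReal, isUnit_iff_ne_zero, isUnit_iff_ne_zero, Ne, Complex.ofReal_eq_zero]

/-- ★ `(A⁻¹)_ℂ = (A_ℂ)⁻¹` for an invertible real matrix. [folklore] -/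
theorem map_ofReal_inv (A : Matrix n n ℝ) (hA : IsUnit A.det) : (A⁻¹).map ((↑) : ℝ → ℂ) = (A.map ((↑) : ℝ → ℂ))⁻¹ := by
  symm
  refine Matrix.inv_eq_right_inv ?_
  rw [← map_ofReal_mul, Matrix.mul_nonsing_inv A hA, map_ofReal_one]

/-- Entries: `((A_ℂ)⁻¹)(i,j) = (A⁻¹(i,j) : ℂ)`. [folklore] -/
theorem map_ofReal_inv_apply (A : Matrix n n ℝ) (hA : IsUnit A.det) (i j : n) : (A.map ((↑) : ℝ → ℂ))⁻¹ i j = ((A⁻¹ i j : ℝ) : ℂ) := by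
  rw [← map_ofReal_inv A hA, Matrix.map_apply]

end MapOfReal

/-! ## §2 The two block means of the tree coincide -/

section BlockMeans

variable {d : ℕ} (N : ℕ) [NeZero N] (M : Fin (d + 1) → ℕ) [hM : ∀ μ, NeZero (M μ)]

/-- `blockOf(Nb + j) = b`. [cite: King1986, (2.11) p.653] -/
theorem blockOf_bpt (b : Tor M) (j : Fin (d + 1) → Fin N) : blockOf N M (bpt N M b j) = b := by
  rw [← site_eq_bpt]; exact blockOf_site N M b j

/-- ★★ **THE b05 BLOCK MEAN IS KING's BLOCK MEAN**: `B5Block118.QsOp N M = (King1986.Torus.Qmat N M)_ℂ` (both are `N^{−(d+1)}·[x ∈ B(y)]`).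
[cite: King1986, (2.11) p.653, (4.1)–(4.3) p.670; Balaban1984PropagatorsI, (1.20) p.20] -/
theorem QsOp_eq_map_Qmat : QsOp N M = (Qmat N M).map ((↑) : ℝ → ℂ) := by
  ext y x
  obtain ⟨b, j, rfl⟩ := exists_bpt_eq N (M := M) x
  rw [← QsOpTw_one, QsOpTw_apply_bpt, Matrix.map_apply, Qmat, blockOf_bpt, twPow_one]
  by_cases h : y = b
  · subst h; simp
  · rw [if_neg h, if_neg (Ne.symm h), Complex.ofReal_zero]

/-- The twisted mean at `ω ≡ 1` is King's mean. [cite: King1986, (2.11) p.653] -/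
theorem QsOpTw_one_eq_map_Qmat : QsOpTw N M (1 : Fin (d + 1) → ℂ) = (Qmat N M).map ((↑) : ℝ → ℂ) := by
  rw [QsOpTw_one, QsOp_eq_map_Qmat]

/-- King's `η`-adjoint at `ω ≡ 1`: `Q^{1*} = (N^{d+1}·Qmatᵀ)_ℂ`. [cite: King1986, (2.13) p.653; Balaban1984PropagatorsI, (1.74) p.30] -/
theorem kingQadjTw_one_eq_map : kingQadjTw N M (1 : Fin (d + 1) → ℂ) = (((N : ℝ) ^ (d + 1)) • (Qmat N M)ᵀ).map ((↑) : ℝ → ℂ) := by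
  rw [kingQadjTw, QsOpTw_one_eq_map_Qmat, conjTranspose_map_ofReal, map_ofReal_smul]
  push_cast; rfl

/-- `Q^{1*}Q^1 = (blockProj)_ℂ` — King's block projector `Q^*Q` (tree `transpose_Qmat_mul_Qmat`). [cite: King1986, (4.36) p.674, (2.13) p.653] -/
theorem kingQadjTw_one_mul_QsOpTw_one : kingQadjTw N M (1 : Fin (d + 1) → ℂ) * QsOpTw N M (1 : Fin (d + 1) → ℂ) = (blockProj N M).map ((↑) : ℝ → ℂ) := by
  have hN : ((N : ℝ) ^ (d + 1)) ≠ 0 := pow_ne_zero _ (by exact_mod_cast NeZero.ne N)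
  rw [kingQadjTw_one_eq_map, QsOpTw_one_eq_map_Qmat, ← map_ofReal_mul, Matrix.smul_mul, transpose_Qmat_mul_Qmat, smul_smul, mul_inv_cancel₀ hN, one_smul]

end BlockMeans

/-! ## §3 King's full operator, effective Laplacian and block-field covariance at `ω ≡ 1` -/

section Effective

variable {d : ℕ} (N : ℕ) [NeZero N] (M : Fin (d + 1) → ℕ) [hM : ∀ μ, NeZero (M μ)]

/-- ★★ **`A₀(1) = (fineOp)_ℂ`**: PART Ͷ-k's full fine operator at the trivial toron is King's real `c(−Δ) + m² + a·Q^*Q` of the tree. [cite: King1986, (2.13) p.653, (4.1)–(4.5) p.670] -/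
theorem fineOpTw_one_eq_map_fineOp (a c m2 : ℝ) : fineOpTw N M a c m2 (1 : Fin (d + 1) → ℂ) = (fineOp N M a c m2).map ((↑) : ℝ → ℂ) := by
  rw [fineOpTw, kingQadjTw_one_mul_QsOpTw_one, ← twistOf_zero, toronOp_zero_eq_map_lapF, fineOp, map_ofReal_add, map_ofReal_smul]

/-- ★★★ **`Δ^1_eff = (King1986.effLaplacian)_ℂ`**: PART Ͷ-k's toron effective Laplacian at `ω ≡ 1` is King's real effective Laplacian `a − a²N^{d+1}·Q·A₀⁻¹·Qᵀ` of the tree mapped to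
`ℂ` (`a, c ≥ 0`, `m² > 0`). [cite: King1986, (2.14) p.653, (4.5) p.670] -/
theorem effLapTw_one_eq_map_effLaplacian {a c m2 : ℝ} (ha : 0 ≤ a) (hc : 0 ≤ c) (hm : 0 < m2) :
    effLapTw N M a c m2 (1 : Fin (d + 1) → ℂ) = (effLaplacian N M a c m2).map ((↑) : ℝ → ℂ) := by
  have hu : IsUnit (fineOp N M a c m2).det := (Matrix.isUnit_iff_isUnit_det _).mp (fineOp_isUnit N M ha hc hm)
  rw [effLapTw, fineOpTw_one_eq_map_fineOp, QsOpTw_one_eq_map_Qmat, kingQadjTw_one_eq_map, ← map_ofReal_inv _ hu, ← map_ofReal_mul, ← map_ofReal_mul, effLaplacian,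
    map_ofReal_sub, map_ofReal_smul, map_ofReal_smul, map_ofReal_one, Matrix.mul_smul, map_ofReal_smul, smul_smul]
  push_cast; ring_nf

/-- ★★ **KING's REAL EFFECTIVE LAPLACIAN IS INVERTIBLE FOR EVERY `c ≥ 0`** (`a > 0`, `m² > 0`; the tree's `effLaplacian_isUnit` is the case `c = N²`): by the bridge and Ͷ-n's
`isUnit_effLapTw`. [cite: King1986, (2.16) p.653] -/
theorem isUnit_det_effLaplacian {a c m2 : ℝ} (ha : 0 < a) (hc : 0 ≤ c) (hm : 0 < m2) : IsUnit (effLaplacian N M a c m2).det := by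
  rw [← isUnit_det_map_ofReal_iff, ← effLapTw_one_eq_map_effLaplacian N M ha.le hc hm, ← Matrix.isUnit_iff_isUnit_det]
  exact isUnit_effLapTw N M ha hc hm (by simp)

/-- ★★★ **THE BLOCK-FIELD COVARIANCES COINCIDE**: `(Δ^1_eff)⁻¹ = ((King1986.effLaplacian …)⁻¹)_ℂ` (`a > 0`, `c ≥ 0`, `m² > 0`). [cite: King1986, (2.16) p.653, (4.38) p.674] -/
theorem effLapTw_one_inv_eq_map {a c m2 : ℝ} (ha : 0 < a) (hc : 0 ≤ c) (hm : 0 < m2) :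
    (effLapTw N M a c m2 (1 : Fin (d + 1) → ℂ))⁻¹ = ((effLaplacian N M a c m2)⁻¹).map ((↑) : ℝ → ℂ) := by
  rw [effLapTw_one_eq_map_effLaplacian N M ha.le hc hm, map_ofReal_inv _ (isUnit_det_effLaplacian N M ha hc hm)]

/-- ★★★ Entrywise: `(Δ^1_eff)⁻¹(b,b′) = ((King1986.effLaplacian N M a c m²)⁻¹(b,b′) : ℂ)` — every tree theorem about King's `A = 0` block-field covariance is a theorem about PART Ͷ's
letters at `ω ≡ 1`. [cite: King1986, (2.16) p.653, (4.38) p.674] -/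
theorem effLapTw_one_inv_apply {a c m2 : ℝ} (ha : 0 < a) (hc : 0 ≤ c) (hm : 0 < m2) (b b' : Tor M) :
    (effLapTw N M a c m2 (1 : Fin (d + 1) → ℂ))⁻¹ b b' = (((effLaplacian N M a c m2)⁻¹ b b' : ℝ) : ℂ) := by
  rw [effLapTw_one_inv_eq_map N M ha hc hm, Matrix.map_apply]

/-- Moduli: `‖(Δ^1_eff)⁻¹(b,b′)‖ = |(King1986.effLaplacian …)⁻¹(b,b′)|`. [cite: King1986, (4.38) p.674] -/
theorem norm_effLapTw_one_inv_apply {a c m2 : ℝ} (ha : 0 < a) (hc : 0 ≤ c) (hm : 0 < m2) (b b' : Tor M) :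
    ‖(effLapTw N M a c m2 (1 : Fin (d + 1) → ℂ))⁻¹ b b'‖ = |(effLaplacian N M a c m2)⁻¹ b b'| := by
  rw [effLapTw_one_inv_apply N M ha hc hm, Complex.norm_real, Real.norm_eq_abs]

/-- Differences at two spacings: `(Δ^1_{eff,N₁})⁻¹(b,b′) − (Δ^1_{eff,N₂})⁻¹(b,b′)` is the real difference of the tree's covariances, as a complex number. [cite: King1986, (4.38) p.674] -/
theorem effLapTw_one_inv_sub_apply (N₁ N₂ : ℕ) [NeZero N₁] [NeZero N₂] {a₁ a₂ c₁ c₂ m2 : ℝ} (ha₁ : 0 < a₁) (ha₂ : 0 < a₂) (hc₁ : 0 ≤ c₁) (hc₂ : 0 ≤ c₂) (hm : 0 < m2)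
    (b b' : Tor M) :
    (effLapTw N₁ M a₁ c₁ m2 (1 : Fin (d + 1) → ℂ))⁻¹ b b' - (effLapTw N₂ M a₂ c₂ m2 (1 : Fin (d + 1) → ℂ))⁻¹ b b'
      = (((effLaplacian N₁ M a₁ c₁ m2)⁻¹ b b' - (effLaplacian N₂ M a₂ c₂ m2)⁻¹ b b' : ℝ) : ℂ) := by
  rw [effLapTw_one_inv_apply N₁ M ha₁ hc₁ hm, effLapTw_one_inv_apply N₂ M ha₂ hc₂ hm, Complex.ofReal_sub]

end Effective

end Summit.QuantumFields.YangMills.BalabanUVNodes.N15KingModelRung.Cover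

end
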